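/-
Origin: expansion seat `planner-pub-hodgecm-pv03-0`, handover 2026-08-18T03:28:28Z (`HOME/pub-hodgecm-pv03/lean/Pv03/PerL34/WedgeNonvanishing.lean`, md5 f7199987, 280 lines);
landed by the gen-5 packager in gate run 18 as `HodgeCM/PerL34/WedgeNonvanishing.lean` (verbatim).
-/
/-
pub-hodgecm cell — DAG-node prover pv03 (session planner-pub-hodgecm-pv03-0, unit pub-hodgecm-pv03).
Node N33 of HOME/LEMMAS.md (carver v1): PerL v5 Proposition 4.3 `prop:S12` ITSELF (tex ll. 639–642), assembled
from its proof-steps N33c (the spans `𝒰_i`), N33d (membership in `S₁₂`, FIXED lines — the R1 repair) and N33e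
(the line-field contradiction), which are separate nodes (N33d = pv08, N33e = pv01 at 03:23Z).
Intended final place: `HodgeCM/PerL34/WedgeNonvanishing.lean` (module root here is `Pv03` only because
`check-wip --root` cannot host a `HodgeCM/` directory next to the package build; rename on landing).
Pure Mathlib: NO cited fact is consumed in this file; the three step-statements enter as explicit hypotheses
typed VERBATIM from the tex blocks (LEMMAS.md §5) over the abstract shell of pv01's `LineField.lean`
(same `StableUnder`, same conclusion shape), so that `N33_of_steps` composes with pv01's `exists_wedge_ne_zero`.
-/
import Mathlib.Topology.Algebra.MulAction
import Mathlib.Analysis.Complex.Basic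
import Mathlib.LinearAlgebra.Dual.Lemmas
import Mathlib.LinearAlgebra.LinearIndependent.Lemmas

set_option autoImplicit false

/-!
# N33 — PerL v5 Proposition 4.3 (`prop:S12`), tex ll. 639–642, from its proof-steps

VERBATIM (PerL v5 = `inputs/2001/…galois-closure__free__y1__paper__paper.tex`, blob d912a121):

```
639: \begin{proposition}\label{prop:S12}
640: There are allowed data of types $\Psi_1,\Psi_2$ and holomorphic $1$-forms $u_j\in(\pi_j\otimes\tau)^{K_\infty}$ with $u_1\wedge
641: u_2\ne0$. In particular $S_{12}\ne0$.
642: \end{proposition}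
```

## Dictionary (LEMMAS.md §3 D6 shell, as in pv01's N33e file `LineField.lean`)

* `X` — the ball `𝔹²`; `G` — `U(2,1) = U(V_{3,ι₁})(ℝ)` acting on `X`; `W` — the cotangent fibre `ℂ²`
  (`T^*𝔹² = 𝔹² × ℂ²` trivialised by `dz₁, dz₂`); a one-form is a function `u : X → W`; `Δ ≤ G` — the image of
  `G_U(L₀)`; `A : G → X → (W →L[ℂ] W)` — the derivative cocycle through which `γ^*` acts on one-forms
  (`StableUnder`, copied letter for letter from pv01 so that the two files compose definitionally).
* `u₁ ∧ u₂ ≠ 0` (as a 2-form on `𝔹²`) ⟺ `∃ x, LinearIndependent ℂ ![u₁ x, u₂ x]` (a 2-form on a surface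
  vanishes iff its `dz₁∧dz₂`-coefficient `det(u₁(x), u₂(x))` vanishes at every point).
* For `i = 1, 2`: `D i` — the automorphic characters `χ'_i` of `[U(W_i)]` of archimedean type `e(Ψ_i)`, for the
  FIXED `(W_i, μ_i)` of §3.2 (l. 644); `gen i d` — the subspace `{u_f : f ∈ Θ_i(χ'_i)[𝔭₊]}` of one-forms of the
  datum `d = χ'_i` (ll. 645–657; a subspace because `f ↦ u_f` is linear); `allowed i d` — "`(W_i, μ_i, χ'_i)` is
  an allowed datum" (Def. 3.2, ll. 269–279); `𝒰 i := ⨆ d, gen i d` — the span of l. 658,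
  `𝒰_i := span{u_f : f ∈ Θ_i(χ'_i)[𝔭₊], χ'_i automorphic of type e(Ψ_i)}`.
* `S₁₂` — the closed span of §3.3 (l. 349), an abstract `ℂ`-submodule of an abstract space `H` here.

## What is PROVED here (kernel-checked, Mathlib only)

* `N33_of_steps` : `N33c_statement → N33d_statement → N33e_statement → (L4.2(b): every datum is allowed) →
  N33_statement` — the proposition from its proof-steps, INCLUDING the step the tex leaves implicit at l. 681
  ("So some `u₁∧u₂≠0` with `u_j∈𝒰_j`" ⇒ the proposition's `u_j ∈ (π_j⊗τ)^{K_∞}` for ONE datum each): an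
  element of `𝒰_j` is a finite sum over SEVERAL characters `χ'_j`; the passage to a single datum is the
  bilinearity of `(u₁,u₂) ↦ u₁(x)∧u₂(x)`, proved as `exists_mem_of_exists_mem_span` /
  `exists_mem_iSup_gen` via `2×2` minors against linear functionals (`minorAt`,
  `exists_minor_ne_zero_of_linearIndependent`, `minor_eq_zero_of_not_linearIndependent`).
* Nothing else: N33c, N33d, N33e and L4.2(b) are HYPOTHESES (statements under adjudication, other nodes).

## Labels (cell ABSOLUTE RULE)

Every hypothesis of `N33_of_steps` is a node of LEMMAS.md (U = under adjudication, proved or split by its own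
seat): N33c (U), N33d (U; pv08), N33e (U; pv01 — kernel-checked over this shell modulo its PRINT inputs real
approximation [San Cor. 3.5(iii)] / [PR Thm. 7.7] and the isotropy representation), N31 = L4.2(b) (U; pv05–pv15).
No PRINT fact and no internal statement is consumed AS A FACT in this file.
-/

namespace HodgeCM
namespace PerL34
namespace WedgeNonvanishing

open Set

/-! ### Part A — `2 × 2` minors: pointwise non-vanishing of a wedge passes to generators -/

section Minors

variable {X W : Type*} [AddCommGroup W] [Module ℂ W]

/-- The `2×2` minor of the pair `(u x, v x)` against two linear functionals `φ, ψ`, as a bilinear map in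
`(u, v)`: `φ(u x) ψ(v x) − φ(v x) ψ(u x)`. -/
def minorAt (φ ψ : W →ₗ[ℂ] ℂ) (x : X) : (X → W) →ₗ[ℂ] (X → W) →ₗ[ℂ] ℂ :=
  LinearMap.mk₂ ℂ (fun u v => φ (u x) * ψ (v x) - φ (v x) * ψ (u x))
    (fun u u' v => by simp only [Pi.add_apply, map_add]; ring)
    (fun c u v => by simp only [Pi.smul_apply, map_smul, smul_eq_mul]; ring)
    (fun u v v' => by simp only [Pi.add_apply, map_add]; ring)
    (fun c u v => by simp only [Pi.smul_apply, map_smul, smul_eq_mul]; ring)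

/-- (Ported verbatim from the HodgeCMPerL package; no docstring in the source.) -/
@[simp] theorem minorAt_apply (φ ψ : W →ₗ[ℂ] ℂ) (x : X) (u v : X → W) :
    minorAt φ ψ x u v = φ (u x) * ψ (v x) - φ (v x) * ψ (u x) := rfl

/-- A linearly DEPENDENT pair has all `2×2` minors zero. -/
theorem minor_eq_zero_of_not_linearIndependent {a b : W} (h : ¬ LinearIndependent ℂ ![a, b])
    (φ ψ : W →ₗ[ℂ] ℂ) : φ a * ψ b - φ b * ψ a = 0 := by
  rw [LinearIndependent.pair_iff] at h
  push Not at h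
  obtain ⟨s, t, hst, hne⟩ := h
  have h1 : s * φ a + t * φ b = 0 := by
    have := congr_arg φ hst
    simpa only [map_add, map_smul, smul_eq_mul, map_zero] using this
  have h2 : s * ψ a + t * ψ b = 0 := by
    have := congr_arg ψ hst
    simpa only [map_add, map_smul, smul_eq_mul, map_zero] using this
  by_cases hs : s = 0
  · have ht : t ≠ 0 := fun ht => hne hs ht
    rw [hs, zero_mul, zero_add] at h1 h2
    have hb1 : φ b = 0 := (mul_eq_zero.mp h1).resolve_left ht
    have hb2 : ψ b = 0 := (mul_eq_zero.mp h2).resolve_left ht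
    rw [hb1, hb2]; ring
  · have key : s * (φ a * ψ b - φ b * ψ a) = 0 := by linear_combination ψ b * h1 - φ b * h2
    exact (mul_eq_zero.mp key).resolve_left hs

/-- A linearly INDEPENDENT pair has a nonzero `2×2` minor against some pair of linear functionals. -/
theorem exists_minor_ne_zero_of_linearIndependent {a b : W} (h : LinearIndependent ℂ ![a, b]) :
    ∃ φ ψ : W →ₗ[ℂ] ℂ, φ a * ψ b - φ b * ψ a ≠ 0 := by
  have hpair := LinearIndependent.pair_iff.mp h
  -- `a ∉ ℂ b` and `b ∉ ℂ a`
  have ha : a ∉ (ℂ ∙ b) := by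
    intro ha
    obtain ⟨c, hc⟩ := Submodule.mem_span_singleton.mp ha
    have := hpair 1 (-c) (by rw [one_smul, neg_smul, ← hc]; exact add_neg_cancel _)
    exact one_ne_zero this.1
  have hb : b ∉ (ℂ ∙ a) := by
    intro hb
    obtain ⟨c, hc⟩ := Submodule.mem_span_singleton.mp hb
    have := hpair (-c) 1 (by rw [one_smul, neg_smul, ← hc]; exact neg_add_cancel _)
    exact one_ne_zero this.2
  obtain ⟨φ, hφa, hφb⟩ := Submodule.exists_dual_map_eq_bot_of_notMem ha inferInstance
  obtain ⟨ψ, hψb, hψa⟩ := Submodule.exists_dual_map_eq_bot_of_notMem hb inferInstance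
  have hφb' : φ b = 0 := by
    have : φ b ∈ Submodule.map φ (ℂ ∙ b) := Submodule.mem_map_of_mem (Submodule.mem_span_singleton_self b)
    rw [hφb] at this
    exact (Submodule.mem_bot ℂ).mp this
  have hψa' : ψ a = 0 := by
    have : ψ a ∈ Submodule.map ψ (ℂ ∙ a) := Submodule.mem_map_of_mem (Submodule.mem_span_singleton_self a)
    rw [hψa] at this
    exact (Submodule.mem_bot ℂ).mp this
  refine ⟨φ, ψ, ?_⟩
  rw [hφb', hψa', zero_mul, sub_zero]
  exact mul_ne_zero hφa hψb

/-- **Bilinearity step** (implicit at tex l. 681): if some `u₁ ∈ span G₁`, `u₂ ∈ span G₂` have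
`u₁(x) ∧ u₂(x) ≠ 0` at some point, then so do some GENERATORS `g₁ ∈ G₁`, `g₂ ∈ G₂` (at the same point). -/
theorem exists_mem_of_exists_mem_span {G₁ G₂ : Set (X → W)}
    (h : ∃ u₁ ∈ Submodule.span ℂ G₁, ∃ u₂ ∈ Submodule.span ℂ G₂, ∃ x : X, LinearIndependent ℂ ![u₁ x, u₂ x]) :
    ∃ g₁ ∈ G₁, ∃ g₂ ∈ G₂, ∃ x : X, LinearIndependent ℂ ![g₁ x, g₂ x] := by
  obtain ⟨u₁, hu₁, u₂, hu₂, x, hli⟩ := h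
  obtain ⟨φ, ψ, hminor⟩ := exists_minor_ne_zero_of_linearIndependent hli
  by_contra H
  push Not at H
  set B := minorAt (X := X) φ ψ x with hB
  have key : ∀ v₁ ∈ Submodule.span ℂ G₁, ∀ v₂ ∈ Submodule.span ℂ G₂, B v₁ v₂ = 0 := by
    intro v₁ hv₁
    have h1 : ∀ g₂ ∈ G₂, B v₁ g₂ = 0 := by
      intro g₂ hg₂
      have hle : Submodule.span ℂ G₁ ≤ LinearMap.ker (B.flip g₂) := Submodule.span_le.mpr fun g₁ hg₁ => by
        simp only [SetLike.mem_coe, LinearMap.mem_ker, LinearMap.flip_apply, hB, minorAt_apply]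
        exact minor_eq_zero_of_not_linearIndependent (H g₁ hg₁ g₂ hg₂ x) φ ψ
      simpa only [LinearMap.mem_ker, LinearMap.flip_apply] using hle hv₁
    have hle : Submodule.span ℂ G₂ ≤ LinearMap.ker (B v₁) := Submodule.span_le.mpr fun g₂ hg₂ => by
      simpa only [SetLike.mem_coe, LinearMap.mem_ker] using h1 g₂ hg₂
    intro v₂ hv₂
    simpa only [LinearMap.mem_ker] using hle hv₂
  exact hminor (by simpa only [hB, minorAt_apply] using key u₁ hu₁ u₂ hu₂)

/-- The same for spans of FAMILIES of subspaces, `𝒰ᵢ = ⨆ d, genᵢ d` (l. 658: the span over all characters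
`χ'_i`): a non-vanishing wedge of elements of `𝒰₁, 𝒰₂` yields one of elements of `gen₁ d₁, gen₂ d₂` for
SINGLE data `d₁, d₂`. -/
theorem exists_mem_iSup_gen {D₁ D₂ : Type*} (gen₁ : D₁ → Submodule ℂ (X → W))
    (gen₂ : D₂ → Submodule ℂ (X → W))
    (h : ∃ u₁ ∈ ⨆ d, gen₁ d, ∃ u₂ ∈ ⨆ d, gen₂ d, ∃ x : X, LinearIndependent ℂ ![u₁ x, u₂ x]) :
    ∃ d₁ d₂, ∃ g₁ ∈ gen₁ d₁, ∃ g₂ ∈ gen₂ d₂, ∃ x : X, LinearIndependent ℂ ![g₁ x, g₂ x] := by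
  rw [Submodule.iSup_eq_span, Submodule.iSup_eq_span] at h
  obtain ⟨g₁, hg₁, g₂, hg₂, x, hli⟩ := exists_mem_of_exists_mem_span h
  obtain ⟨d₁, hd₁⟩ := Set.mem_iUnion.mp hg₁
  obtain ⟨d₂, hd₂⟩ := Set.mem_iUnion.mp hg₂
  exact ⟨d₁, d₂, g₁, hd₁, g₂, hd₂, x, hli⟩

end Minors

/-! ### Part B — the shell, the step statements (verbatim-typed), and the assembly `N33_of_steps` -/

section Shell

variable {G X W : Type*} [Group G] [TopologicalSpace X] [MulAction G X]
  [NormedAddCommGroup W] [NormedSpace ℂ W]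

/-- `Δ`-stability of a space `𝒰` of `W`-valued one-forms under push-forward through the cocycle `A`
(IDENTICAL to pv01's `HodgeCM.PerL34.LineField.StableUnder`, N33e; PerL l. 659 "`𝒰_i` … stable under `γ^*`
for `γ ∈ G_U(L₀)`"): for `γ ∈ Δ` and `u ∈ 𝒰` the form `γ ⋆ u`, `(γ ⋆ u)(γ • x) = A γ x (u x)`, lies in `𝒰`. -/
def StableUnder (Δ : Subgroup G) (A : G → X → (W →L[ℂ] W)) (𝒰 : Submodule ℂ (X → W)) : Prop :=
  ∀ γ : G, γ ∈ Δ → ∀ u ∈ 𝒰, ∃ u' ∈ 𝒰, ∀ x : X, u' (γ • x) = A γ x (u x)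

variable (Δ : Subgroup G) (A : G → X → (W →L[ℂ] W))
variable {D₁ D₂ : Type*} (gen₁ : D₁ → Submodule ℂ (X → W)) (gen₂ : D₂ → Submodule ℂ (X → W))

/-- **N33c** (PerL v5 Prop. 4.3 proof, tex ll. 658–660), VERBATIM:
```
658: \[\mathcal U_i:=\mathrm{span}\{u_f:\ f\in\Theta_i(\chi'_i)[\fp_+],\ \chi'_i\text{ automorphic of type }e(\Psi_i)\},\]
659: a complex vector space of holomorphic $1$-forms on $\mathbb B^2$, stable under $\gamma^*$ for $\gamma\in G_U(L_0)$, and non-zero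
660: (if $u_f=0$ for all such $f$ then, replacing $f$ by its $G_U(\A_f)$-translates, $f=0$).
```
Typed over the shell with `𝒰ᵢ := ⨆ d, genᵢ d`: non-zero, consisting of CONTINUOUS forms (holomorphic ⇒
continuous; continuity is all that N33e consumes — the weakening is on the safe side and recorded), and
`Δ`-stable. -/
def N33c_statement : Prop :=
  ((⨆ d, gen₁ d) ≠ ⊥ ∧ (∀ u ∈ ⨆ d, gen₁ d, Continuous u) ∧ StableUnder Δ A (⨆ d, gen₁ d)) ∧
  ((⨆ d, gen₂ d) ≠ ⊥ ∧ (∀ u ∈ ⨆ d, gen₂ d, Continuous u) ∧ StableUnder Δ A (⨆ d, gen₂ d))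

/-- **N33d, conclusion used by the proposition** (PerL v5 Prop. 4.3 proof, tex ll. 660–667), VERBATIM:
```
660: (if $u_f=0$ for all such $f$ then, replacing $f$ by its $G_U(\A_f)$-translates, $f=0$). Every pair $(\chi'_1,\chi'_2)$ of such
661: characters gives an allowed pair $((W_1,\mu_1,\chi'_1),(W_2,\mu_2,\chi'_2))$ for the FIXED lines and splitting characters
662: ($\mu_1\mu_2=\mu_W$ by the choice of \S\ref{ss:seesaw}; non-vanishing by Lemma~\ref{lem:chars}(b)), so for $f_j=\theta(\phi_j,\chi'
663: _j)\in\Theta_j(\chi'_j)[\fp_+]$ the adelic wedge $u_{f_1}\wedge u_{f_2}$ of \S\ref{ss:forms} is one of the generators of $S_{12}$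
664: exhibited in the proof of Lemma~\ref{lem:S12} ($u_{f_1}\wedge u_{f_2}=\vartheta_{T,\chi_{12}}(\mathrm{pr}_\kappa\Phi')$); by
665: bilinearity the same holds for wedges of arbitrary elements of $\mathcal U_1$ and $\mathcal U_2$ (finite sums of generators). Hence
666: if $u_1\wedge u_2\ne0$ on $\mathbb B^2$ for some $u_1\in\mathcal U_1$, $u_2\in\mathcal U_2$, then the corresponding element of
667: $S_{12}$ is a non-zero continuous function and $S_{12}\ne0$. Suppose $u_1\wedge u_2=0$ for all $u_1\in\mathcal U_1$, $u_2\in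
```
Typed: the "Hence" sentence (ll. 665–667) — a non-vanishing wedge of elements of `𝒰₁, 𝒰₂` forces `S₁₂ ≠ 0`
(`S₁₂` an abstract submodule of an abstract `ℂ`-module `H`; the generator identity of ll. 660–665 is the
MECHANISM of node N33d and lives in its own file). -/
def N33d_statement {H : Type*} [AddCommGroup H] [Module ℂ H] (S₁₂ : Submodule ℂ H) : Prop :=
  (∃ u₁ ∈ ⨆ d, gen₁ d, ∃ u₂ ∈ ⨆ d, gen₂ d, ∃ x : X, LinearIndependent ℂ ![u₁ x, u₂ x]) → S₁₂ ≠ ⊥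

/-- **N33e** (PerL v5 Prop. 4.3 proof, tex ll. 667–681: the line-field contradiction), typed as its
INPUT/OUTPUT contract over the shell — exactly the shape of pv01's kernel-checked
`HodgeCM.PerL34.LineField.exists_wedge_ne_zero` once that theorem's own shell hypotheses (density of `Δ` = real
approximation [San Cor. 3.5(iii)], [PR Thm. 7.7]; transitivity of `U(2,1)` on `𝔹²`; the isotropy
representation; injectivity/continuity of the cocycle) are supplied: two non-zero `Δ`-stable spaces of
continuous one-forms contain `u₁, u₂` with `u₁(x) ∧ u₂(x) ≠ 0` at some point.  VERBATIM conclusion, l. 680–681: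
"So some $u_1\wedge u_2\ne0$ with $u_j\in \mathcal U_j$". -/
def N33e_statement (𝒰₁ 𝒰₂ : Submodule ℂ (X → W)) : Prop :=
  𝒰₁ ≠ ⊥ → 𝒰₂ ≠ ⊥ → (∀ u ∈ 𝒰₁, Continuous u) → (∀ u ∈ 𝒰₂, Continuous u) →
    StableUnder Δ A 𝒰₁ → StableUnder Δ A 𝒰₂ →
      ∃ u₁ ∈ 𝒰₁, ∃ u₂ ∈ 𝒰₂, ∃ x : X, LinearIndependent ℂ ![u₁ x, u₂ x]

variable (allowed₁ : D₁ → Prop) (allowed₂ : D₂ → Prop)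

/-- **N33 = PerL v5 Proposition 4.3 `prop:S12`** (tex ll. 639–642), VERBATIM:
```
640: There are allowed data of types $\Psi_1,\Psi_2$ and holomorphic $1$-forms $u_j\in(\pi_j\otimes\tau)^{K_\infty}$ with $u_1\wedge
641: u_2\ne0$. In particular $S_{12}\ne0$.
```
Typed over the shell: there are data `d₁ : D₁`, `d₂ : D₂` (characters `χ'_1, χ'_2` of types `e(Ψ₁), e(Ψ₂)` for
the fixed `(W_i, μ_i)`), both ALLOWED, and one-forms `u_j ∈ gen_j d_j` (`= {u_f : f ∈ Θ_j(χ'_j)[𝔭₊]} ⊆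
(π_j ⊗ τ)^{K_∞}`, `π_j = Θ^{W_j}_{μ_j}(χ'_j)`) with `u₁ ∧ u₂ ≠ 0` (non-vanishing at some point of `𝔹²`); and
`S₁₂ ≠ 0`. -/
def N33_statement {H : Type*} [AddCommGroup H] [Module ℂ H] (S₁₂ : Submodule ℂ H) : Prop :=
  (∃ d₁ d₂, allowed₁ d₁ ∧ allowed₂ d₂ ∧
      ∃ u₁ ∈ gen₁ d₁, ∃ u₂ ∈ gen₂ d₂, ∃ x : X, LinearIndependent ℂ ![u₁ x, u₂ x]) ∧
    S₁₂ ≠ ⊥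

/-- **Assembly of Proposition 4.3 from its proof-steps** (PerL v5 ll. 643–682): N33c (the spans), N33e (the
line-field contradiction) and N33d (membership in `S₁₂`), together with Lemma 4.2(b) (node N31: EVERY datum
`(W_i, μ_i, χ'_i)` with `χ'_i` of type `e(Ψ_i)` is allowed, ll. 660–662 "non-vanishing by Lemma lem:chars(b)"),
give the proposition — the passage from `u_j ∈ 𝒰_j` (l. 681) to a SINGLE datum `u_j ∈ gen_j d_j` being the
bilinearity step `exists_mem_iSup_gen`. -/
theorem N33_of_steps {H : Type*} [AddCommGroup H] [Module ℂ H] (S₁₂ : Submodule ℂ H)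
    (hc : N33c_statement Δ A gen₁ gen₂)
    (hd : N33d_statement gen₁ gen₂ S₁₂)
    (he : N33e_statement Δ A (⨆ d, gen₁ d) (⨆ d, gen₂ d))
    (hL42b₁ : ∀ d, allowed₁ d) (hL42b₂ : ∀ d, allowed₂ d) :
    N33_statement gen₁ gen₂ allowed₁ allowed₂ S₁₂ := by
  obtain ⟨⟨hne₁, hcont₁, hstab₁⟩, ⟨hne₂, hcont₂, hstab₂⟩⟩ := hc
  have hwedge := he hne₁ hne₂ hcont₁ hcont₂ hstab₁ hstab₂
  refine ⟨?_, hd hwedge⟩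
  obtain ⟨d₁, d₂, g₁, hg₁, g₂, hg₂, x, hli⟩ := exists_mem_iSup_gen gen₁ gen₂ hwedge
  exact ⟨d₁, d₂, hL42b₁ d₁, hL42b₂ d₂, g₁, hg₁, g₂, hg₂, x, hli⟩

/-- The proposition's headline consequence (l. 641 "In particular `S₁₂ ≠ 0`"), isolated. -/
theorem S12_ne_bot_of_steps {H : Type*} [AddCommGroup H] [Module ℂ H] (S₁₂ : Submodule ℂ H)
    (hc : N33c_statement Δ A gen₁ gen₂) (hd : N33d_statement gen₁ gen₂ S₁₂)
    (he : N33e_statement Δ A (⨆ d, gen₁ d) (⨆ d, gen₂ d)) : S₁₂ ≠ ⊥ := by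
  obtain ⟨⟨hne₁, hcont₁, hstab₁⟩, ⟨hne₂, hcont₂, hstab₂⟩⟩ := hc
  exact hd (he hne₁ hne₂ hcont₁ hcont₂ hstab₁ hstab₂)

end Shell

end WedgeNonvanishing
end PerL34
end HodgeCM
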